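import Summits.QuantumFields.YangMills.Theorems.BalabanUVNodesK0Stub1FlatChartCriticalityTransfer
import Summits.QuantumFields.YangMills.Theorems.BalabanUVNodesK0Stub1FlatChartSlN
import Summits.QuantumFields.YangMills.Theorems.BalabanUVNodesK0Stub1ChartDAnalytic
import HarnessLib

/-!
# K0⁷ STUB 1 (V20-G stub 1-G `stub_prop8StepCoPG13`), sub-target S4a — **THE KNIT, CONFIGURATION HALF: the Wilson action is STATIONARY along the ♭ CHART LINE
# `t ↦ (A′₁ + tδ) − H·Dsel(A′₁ + tδ)` through a fibre-critical point**, `δ` in print's multi-level kernel `ker Qlin♭` — ✓`…K0Stub1FlatChartCriticalityTransfer` §2 with its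
# three analytic inputs (`hAdiff`, `hball`, `hidx`) DISCHARGED from the ♭ chart's letters, and the `SU(N)` reading family SUPPLIED

Cell `pub-ymgap`, width seat `pub-ymgap-k0-s1-w1` g8 (CLAIM-1).  `--kind proof --supports stmt-QuantumFields-20541 --as helper`; count-neutral.  [15] = [Balaban1985Variational];
[B7AVG] = [Balaban1985Averaging]; [B6] = [Balaban1984PropagatorsII]; [III] = [Balaban1988Convergent].

WHY.  On the ♭ road the S4a socket `h127rec` (♭ (127) with `T = 0`: `⟪δ, Δ₁A′₁⟫ + ⟨W, δ⟩ = 0` for `δ ∈ ker Qlin♭`) is «stationarity of `t ↦ 𝔄(e^{iη·chart♭(A′₁ + tδ)})` at `0`» +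
S4b's (157) `HasFDerivAt` (k0-s1-w2 C″∕D″∕D‴, `inner_hessOpAt_add_re_eq_zero_of_stationary`).  g7's ✓`hasDerivAt_wilsonAction4_zero_of_flatChart_critical` proves the
stationarity for an ABSTRACT complex charted family `A` with `hAdiff`∕`hball`∕`hidx` displayed.  THIS FILE instantiates it at the ♭ chart line in the letters of k0-s1-w4's
✓`exists_chartDFlat_himp_herm0_T4` ∕ k0-s1-w2's ✓D″ `exists_sectF_W_flatScaled_atRecord` — `H` a ℂ-linear map `(BondIdx D → M_N(ℂ)) → (bonds → M_N(ℂ))` (the ♭ right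
inverse; no kernel formula needed), `Dsel` `C^ω` on the weighted `ε`-ball, (49)♭ `Q♭(A′ − H·Dsel A′) = Qlin♭ A′` (`Qlin♭ = fderiv ℂ (chartLogFlat η D) 0`), the herm0 row, the sup row
of `H` and (55)♭ — and discharges: `hAdiff` (§1: `Dsel` differentiable at `A′₁`, `H` finite-dimensional linear), `hball` (§1: the line stays in the `ε₁`-ball; the charted field in the
`R`-ball by the sup row + (55)♭ + the window `ε₁ + B_f·C_D·ε₁² ≤ R`), `hidx` (§1: (49)♭ + `Qlin♭ δ = 0` ⇒ `Q♭(chart♭(A′₁ + zδ))` CONSTANT in `z` ⇒ g7 ✓`dbarIterU_eq_of_chartLogFlat_eq_of_ball`),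
and the `SU(N)` readings (§1b: `A′₁`, `δ` Hermitian-traceless ⇒ the real line is herm0-valued ⇒ k0-s1-w4 ✓`suN_coe_expCfg`).  §1c records the dictionary `ker Qlin♭ =` print's
(2.3)-lettered multi-level kernel `{δ | Q_jδ(c) = 0 ∀ (j,c) ∈ BondIdx D}` (UST ✓`fderiv_chartLogFlat_zero_apply`).

WHAT IS PROVED (sorry-free; no definition; axioms standard; generic `P` in §1, `F : T4Family`, `P = F.P K`, `N ≥ 1` in §2–§4).
* §1 `eventually_weightedBall_line` · ★ `differentiableAt_flatChart_line` · ★ `chartLogFlat_flatChart_line_eq` · `weightedBall_flatChart_of_letters` · `isLevWeight_one_nonneg`;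
  §1b ★ `exists_suReading_family` · `eventually_herm0_flatChart_line`; §1c ★ `fderiv_chartLogFlat_zero_eq_zero_of_lamBond` · ★ `fderiv_chartLogFlat_zero_eq_zero_iff`; `budgets_of_hRL`.
* §2 ★★★ `hasDerivAt_wilsonAction4_zero_of_flatChart_line_critical` — abstract `SU(N)` family `U` reading `e^{iη((A′₁+tδ) − H·Dsel(A′₁+tδ))}` near `0`, criticality of `U 0` in the
  (2.3)-lettered curve form ⟹ **`HasDerivAt (t ↦ 𝔄(U t)) 0 0`**; ★★★ `…_isCritOnFibre` (`Node00.IsCritOnFibre` edition, `bondsOf (𝔹 j) ⊆ LamBond`, levels `≤ k`).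
* §3 ★★★ `exists_suReading_hasDerivAt_wilsonAction4_zero_isCritOnFibre` — herm0 data, `U₀` reading `e^{iη(A′₁ − H·Dsel A′₁)}` critical on the fibre ⟹ `∃ U, U 0 = U₀ ∧ (reads) ∧
  HasDerivAt (𝔄 ∘ U) 0 0` (no cut-off left for the assembler).
* §4 ★★★★ `exists_suReading_hasDerivAt_wilsonAction4_zero_of_letters` — the same with the ball link DISCHARGED from the sup row of `H` + (55)♭ + the window: every hypothesis
  is a conjunct of ✓`exists_chartDFlat_himp_herm0_T4` ∕ D″ VERBATIM, a budget, or a datum (`A′₁`, `δ`, `U₀`, criticality).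
HONEST SCOPE.  First-order calculus + bookkeeping over g7's files and k0-s1-w4's `suN_coe_expCfg`; the ♭ chart's rows ((49)♭, analyticity, herm0, sup row, (55)♭) and the record's
criticality (input (i), K0 road §1; g7 FILE 6 moves it to the Landau∕axial copy) are CONSUMED as hypotheses, not proved; the (157) `HasFDerivAt` turning this stationarity into
`h127rec`∕`h128` is S4b's; NO estimate of Bałaban's proved or asserted; stub 1-G `stub_prop8StepCoPG13` ∕ K0⁷ NOT closed (ONE PEN: not this seat); N07 NOT discharged; counts
unmoved (28∕28 · 5∕27); one finite 𝕋⁴ programme at fixed ε — R4 closes the conditional finite-𝕋⁴ rung `BalabanLadder.UV` only, never the summit; the YM mass gap (Clay) is NOT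
proved by any of this; nothing continuum ∕ ℝ⁴ ∕ OS.  No `sorry`, no `def`, no `instance`, no `notation`.

References: [15] T. Bałaban, CMP **102** (1985) 277–309 ((5)–(6) p.278, (20) p.281, (44)–(49) p.285, (55) p.286, (127)–(128) p.297, (152) p.301, (156)–(157) p.302);
[B7AVG] CMP **98** (1985) 17–51 ((92) p.31, (134) p.38); [B6] CMP **96** (1984) 223–250 ((2.3) p.224); [I] CMP **109** (1987) 249–301 ((0.4) p.253); [III] CMP **119** (1988)
243–285 ((2.10)–(2.12) p.256).
-/

set_option autoImplicit false

noncomputable section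

open scoped BigOperators Matrix.Norms.L2Operator Topology ContDiff
open Filter

namespace Summit.QuantumFields.YangMills.Theorems.K0Stub1FlatChartLineStationarity

open Literature.MathematicalPhysics.QuantumFieldTheory.Balaban1983to89
open T4Continuum BlockAveraging ExpMeanLog
open B9AdOrthogonal (herm0)
open B15DeterminingSets (avgFamily bondsOf DetSet)
open B6SectADomainsV1 (Domains)
open B6SectAOperatorsV1 (BondIdx)
open Node00 (avOfRecord IsCritOnFibre)
open Summit.QuantumFields.YangMills.Theorems.Prop8Chart (expCfg coe_expCfg differentiableAt_coe_expCfg)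
open Summit.QuantumFields.YangMills.Theorems.Prop8ChartDoubleBar (dbarIterU chartLogFlat fderiv_chartLogFlat_zero_apply)
open Summit.QuantumFields.YangMills.Theorems.K0FlatCubeOpsTextP (IsLevWeight)
open Summit.QuantumFields.YangMills.Theorems.K0Stub1ChartDAnalytic (isOpen_weightedBall)
open Summit.QuantumFields.YangMills.Theorems.K0Stub1DoubleBarFibreAtRecordClosed (dbarIterU_eq_of_chartLogFlat_eq_of_ball)
open Summit.QuantumFields.YangMills.Theorems.K0Stub1FlatChartCriticalityTransfer (eventually_ofReal hasDerivAt_wilsonAction4_zero_of_flatChart_critical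
  hasDerivAt_wilsonAction4_zero_of_flatChart_isCritOnFibre)
open Summit.QuantumFields.YangMills.Theorems.K0Stub1FlatChartSlN (suN_coe_expCfg)

variable {P : Params} {N : ℕ}

/-! ## §1  Line lemmas for the ♭ chart `A′ ↦ A′ − H(Dsel A′)` along a complex line `z ↦ A′₁ + z•δ` -/

section Line
variable {D : Domains P}

/-- A complex line `z ↦ A′₁ + z•δ` issued from a point of the OPEN weighted ball `{Y | ∀ b, w₁(b)‖Y b‖ < ε}` stays in the ball for `z` near `0` (finitely many bonds).
[cite: Balaban1985Variational, (152) p.301] -/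
theorem eventually_weightedBall_line (w : ℕ → PBond P 0 → ℝ) (ε : ℝ) (A₁ δ : PBond P 0 → Matrix (Fin N) (Fin N) ℂ) (hA₁ : ∀ b, w 1 b * ‖A₁ b‖ < ε) :
    ∀ᶠ z in 𝓝 (0 : ℂ), ∀ b, w 1 b * ‖(A₁ + z • δ) b‖ < ε := by
  have hcont : Continuous (fun z : ℂ => A₁ + z • δ) := continuous_const.add (continuous_id.smul continuous_const)
  have h0 : (fun z : ℂ => A₁ + z • δ) 0 ∈ {Y : PBond P 0 → Matrix (Fin N) (Fin N) ℂ | ∀ b, w 1 b * ‖Y b‖ < ε} := by simpa using hA₁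
  exact hcont.continuousAt.eventually_mem ((isOpen_weightedBall w ε).mem_nhds h0)

/-- **THE ♭ CHART LINE IS ℂ-DIFFERENTIABLE AT `0`**: for a ℂ-linear `H` (finite dimensions) and `Dsel` `C^ω` on the open weighted ball containing `A′₁`, the charted family
`z ↦ (A′₁ + z•δ) − H(Dsel(A′₁ + z•δ))` is ℂ-differentiable at `z = 0` — the `hAdiff` input of `…FlatChartCriticalityTransfer` §2.
[cite: Balaban1985Variational, (47)-(49) p.285, Prop. 3 p.289] -/
theorem differentiableAt_flatChart_line (w : ℕ → PBond P 0 → ℝ) (ε : ℝ)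
    (H : (BondIdx D → Matrix (Fin N) (Fin N) ℂ) →ₗ[ℂ] (PBond P 0 → Matrix (Fin N) (Fin N) ℂ))
    (Dsel : (PBond P 0 → Matrix (Fin N) (Fin N) ℂ) → (BondIdx D → Matrix (Fin N) (Fin N) ℂ))
    (hcd : ContDiffOn ℂ ω Dsel {Y : PBond P 0 → Matrix (Fin N) (Fin N) ℂ | ∀ b, w 1 b * ‖Y b‖ < ε})
    (A₁ δ : PBond P 0 → Matrix (Fin N) (Fin N) ℂ) (hA₁ : ∀ b, w 1 b * ‖A₁ b‖ < ε) :
    DifferentiableAt ℂ (fun z : ℂ => (A₁ + z • δ) - H (Dsel (A₁ + z • δ))) 0 := by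
  have hline : DifferentiableAt ℂ (fun z : ℂ => A₁ + z • δ) 0 := (differentiableAt_const A₁).add (differentiableAt_id.smul_const δ)
  have hline0 : (fun z : ℂ => A₁ + z • δ) 0 = A₁ := by simp
  have hD : DifferentiableAt ℂ Dsel A₁ :=
    (hcd.differentiableOn (by simp)).differentiableAt ((isOpen_weightedBall w ε).mem_nhds (by simpa using hA₁))
  have hH : Differentiable ℂ (fun X : BondIdx D → Matrix (Fin N) (Fin N) ℂ => H X) := (LinearMap.toContinuousLinearMap H).differentiable
  have hcomp : DifferentiableAt ℂ (fun z : ℂ => Dsel (A₁ + z • δ)) 0 := by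
    have := hD
    rw [← hline0] at this
    exact this.comp 0 hline
  exact hline.sub ((hH _).comp 0 hcomp)

/-- **PINNED `Q♭`-DATA ALONG THE LINE**: if the chart satisfies (49)♭ `Q♭(A′ − H·Dsel A′) = Qlin♭ A′` on the `ε`-ball and `δ` lies in print's multi-level kernel `Qlin♭ δ = 0`
(`Qlin♭ = fderiv ℂ (chartLogFlat η D) 0`), then along the line the double-bar LOG data are constant: `Q♭(chart♭(A′₁ + zδ)) = Q♭(chart♭(A′₁ + 0·δ))` whenever `A′₁ + zδ` is in the ball.
[cite: Balaban1985Variational, (20) p.281, (44)-(49) p.285, (156) p.302] -/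
theorem chartLogFlat_flatChart_line_eq (η : ℝ) (w : ℕ → PBond P 0 → ℝ) (ε : ℝ)
    (H : (BondIdx D → Matrix (Fin N) (Fin N) ℂ) →ₗ[ℂ] (PBond P 0 → Matrix (Fin N) (Fin N) ℂ))
    (Dsel : (PBond P 0 → Matrix (Fin N) (Fin N) ℂ) → (BondIdx D → Matrix (Fin N) (Fin N) ℂ))
    (hfix : ∀ A' : PBond P 0 → Matrix (Fin N) (Fin N) ℂ, (∀ b, w 1 b * ‖A' b‖ < ε) →
      chartLogFlat η D (A' - H (Dsel A')) =
        (fderiv ℂ (chartLogFlat η D : (PBond P 0 → Matrix (Fin N) (Fin N) ℂ) → BondIdx D → Matrix (Fin N) (Fin N) ℂ) 0) A')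
    (A₁ δ : PBond P 0 → Matrix (Fin N) (Fin N) ℂ) (hA₁ : ∀ b, w 1 b * ‖A₁ b‖ < ε)
    (hδ : (fderiv ℂ (chartLogFlat η D : (PBond P 0 → Matrix (Fin N) (Fin N) ℂ) → BondIdx D → Matrix (Fin N) (Fin N) ℂ) 0) δ = 0)
    {z : ℂ} (hz : ∀ b, w 1 b * ‖(A₁ + z • δ) b‖ < ε) :
    chartLogFlat η D ((A₁ + z • δ) - H (Dsel (A₁ + z • δ))) = chartLogFlat η D ((A₁ + (0 : ℂ) • δ) - H (Dsel (A₁ + (0 : ℂ) • δ))) := by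
  have hz0 : ∀ b, w 1 b * ‖(A₁ + (0 : ℂ) • δ) b‖ < ε := by simpa using hA₁
  rw [hfix _ hz, hfix _ hz0, map_add, map_add, map_smul, map_smul, hδ, smul_zero, smul_zero]

/-- **THE CHARTED FIELD STAYS IN THE `R`-BALL** (the (48)-type ball link, discharged from letters): with nonnegative weights, the sup row `w₁(b)‖H X b‖ ≤ B_f·t` of the ♭
right inverse and the (55)♭ row `‖Dsel A′‖ ≤ C_D·ρ′²` on the `ε`-ball, every `A′` with `w₁‖A′‖ < ε₁ ≤ ε` has `w₁(b)‖(A′ − H·Dsel A′)(b)‖ < R` as soon as `ε₁ + B_f·C_D·ε₁² ≤ R`.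
[cite: Balaban1985Variational, (46) p.285, (48) p.285, (55) p.286] -/
theorem weightedBall_flatChart_of_letters (w : ℕ → PBond P 0 → ℝ) (hw0 : ∀ b, 0 ≤ w 1 b) {ε ε₁ R Bf CD : ℝ} (hε₁0 : 0 ≤ ε₁) (hε₁ : ε₁ ≤ ε)
    (hCD : 0 ≤ CD) (hwin : ε₁ + Bf * CD * ε₁ ^ 2 ≤ R)
    (H : (BondIdx D → Matrix (Fin N) (Fin N) ℂ) →ₗ[ℂ] (PBond P 0 → Matrix (Fin N) (Fin N) ℂ))
    (Dsel : (PBond P 0 → Matrix (Fin N) (Fin N) ℂ) → (BondIdx D → Matrix (Fin N) (Fin N) ℂ))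
    (hHB : ∀ (X : BondIdx D → Matrix (Fin N) (Fin N) ℂ) (t : ℝ), 0 ≤ t → (∀ c, ‖X c‖ ≤ t) → ∀ b, w 1 b * ‖H X b‖ ≤ Bf * t)
    (h55 : ∀ A' : PBond P 0 → Matrix (Fin N) (Fin N) ℂ, (∀ b, w 1 b * ‖A' b‖ < ε) →
      ∀ ρ' : ℝ, 0 ≤ ρ' → (∀ b, w 1 b * ‖A' b‖ ≤ ρ') → ∀ i : BondIdx D, ‖Dsel A' i‖ ≤ CD * ρ' ^ 2)
    (A' : PBond P 0 → Matrix (Fin N) (Fin N) ℂ) (hA' : ∀ b, w 1 b * ‖A' b‖ < ε₁) (b : PBond P 0) :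
    w 1 b * ‖(A' - H (Dsel A')) b‖ < R := by
  have hA'ε : ∀ b, w 1 b * ‖A' b‖ < ε := fun b => (hA' b).trans_le hε₁
  have hD : ∀ i, ‖Dsel A' i‖ ≤ CD * ε₁ ^ 2 := h55 A' hA'ε ε₁ hε₁0 (fun b => (hA' b).le)
  have hH : w 1 b * ‖H (Dsel A') b‖ ≤ Bf * (CD * ε₁ ^ 2) := hHB (Dsel A') _ (by positivity) hD b
  calc w 1 b * ‖(A' - H (Dsel A')) b‖ = w 1 b * ‖A' b - H (Dsel A') b‖ := by rfl
    _ ≤ w 1 b * (‖A' b‖ + ‖H (Dsel A') b‖) := mul_le_mul_of_nonneg_left (norm_sub_le _ _) (hw0 b)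
    _ = w 1 b * ‖A' b‖ + w 1 b * ‖H (Dsel A') b‖ := by ring
    _ < ε₁ + Bf * CD * ε₁ ^ 2 := by linarith [hA' b]
    _ ≤ R := hwin

/-- the (152) level weights are nonnegative: `w₁(b) = L^{j(b)}·L^{−k} ≥ 0`. [cite: Balaban1985Variational, (152) p.301] -/
theorem isLevWeight_one_nonneg {k : ℕ} {w : ℕ → PBond P 0 → ℝ} (hw : IsLevWeight P k D w) (b : PBond P 0) : 0 ≤ w 1 b := by
  rw [hw 1 b]; positivity
end Line

/-! ## §1b  `SU(N)` readings of a charted family that is Hermitian-traceless on the real line -/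

section Readings
/-- **AN `SU(N)`-VALUED READING FAMILY**: if the charted family `A` is Hermitian-traceless-valued along the real line near `0` and `U₀` reads `e^{iηA(0)}`, there is a family
`U : ℝ → (bonds → SU(N))` with `U 0 = U₀` reading `e^{iηA(t)}` for real `t` near `0` (cut off outside; k0-s1-w4 ✓`suN_coe_expCfg`).
[cite: Balaban1985Variational, (152) p.301, (156) p.302; Balaban1987RG1, (0.4) p.253] -/
theorem exists_suReading_family (η : ℝ) (A : ℂ → PBond P 0 → Matrix (Fin N) (Fin N) ℂ) (hAh : ∀ᶠ t : ℝ in 𝓝 0, ∀ b, A (↑t : ℂ) b ∈ herm0 (Fin N))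
    (U₀ : GaugeField P 0 (Matrix.specialUnitaryGroup (Fin N) ℂ))
    (hU₀ : ∀ b, ((U₀ b : Matrix.specialUnitaryGroup (Fin N) ℂ) : Matrix (Fin N) (Fin N) ℂ) = ((expCfg η (A 0) b : (Matrix (Fin N) (Fin N) ℂ)ˣ) : _)) :
    ∃ U : ℝ → GaugeField P 0 (Matrix.specialUnitaryGroup (Fin N) ℂ), U 0 = U₀ ∧
      ∀ᶠ t : ℝ in 𝓝 0, ∀ b, ((U t b : Matrix.specialUnitaryGroup (Fin N) ℂ) : Matrix (Fin N) (Fin N) ℂ) =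
        ((expCfg η (A (↑t : ℂ)) b : (Matrix (Fin N) (Fin N) ℂ)ˣ) : _) := by
  classical
  refine ⟨fun t => if ht : t ≠ 0 ∧ ∀ b, A (↑t : ℂ) b ∈ herm0 (Fin N) then fun b => (suN_coe_expCfg η b (ht.2 b)).choose else U₀, ?_, ?_⟩
  · exact dif_neg (fun h => h.1 rfl)
  · filter_upwards [hAh] with t ht
    intro b
    by_cases h0 : t = 0
    · subst h0
      rw [dif_neg (fun h => h.1 rfl), Complex.ofReal_zero]
      exact hU₀ b
    · show (((dite (t ≠ 0 ∧ ∀ b, A (↑t : ℂ) b ∈ herm0 (Fin N)) (fun ht => fun b => (suN_coe_expCfg η b (ht.2 b)).choose) (fun _ => U₀)) b :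
        Matrix.specialUnitaryGroup (Fin N) ℂ) : Matrix (Fin N) (Fin N) ℂ) = _
      rw [dif_pos ⟨h0, ht⟩]
      exact (suN_coe_expCfg η b (ht b)).choose_spec

/-- the ♭ chart line is Hermitian-traceless-valued for REAL parameters near `0`: `A′₁`, `δ` Hermitian-traceless and the chart's herm0 row on the `ε`-ball
(k0-s1-w4 CLAIM-8's conjunct) give `(A′₁ + tδ) − H·Dsel(A′₁ + tδ) ∈ herm0` bondwise. [cite: Balaban1985Variational, (47) p.285, (152) p.301, (156) p.302] -/
theorem eventually_herm0_flatChart_line {D : Domains P} (w : ℕ → PBond P 0 → ℝ) (ε : ℝ)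
    (H : (BondIdx D → Matrix (Fin N) (Fin N) ℂ) →ₗ[ℂ] (PBond P 0 → Matrix (Fin N) (Fin N) ℂ))
    (Dsel : (PBond P 0 → Matrix (Fin N) (Fin N) ℂ) → (BondIdx D → Matrix (Fin N) (Fin N) ℂ))
    (hherm : ∀ A' : PBond P 0 → Matrix (Fin N) (Fin N) ℂ, (∀ b, w 1 b * ‖A' b‖ < ε) → (∀ b, A' b ∈ herm0 (Fin N)) →
      (∀ i, Dsel A' i ∈ herm0 (Fin N)) ∧ ∀ b, (A' - H (Dsel A')) b ∈ herm0 (Fin N))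
    (A₁ δ : PBond P 0 → Matrix (Fin N) (Fin N) ℂ) (hA₁ : ∀ b, w 1 b * ‖A₁ b‖ < ε) (hA₁h : ∀ b, A₁ b ∈ herm0 (Fin N)) (hδh : ∀ b, δ b ∈ herm0 (Fin N)) :
    ∀ᶠ t : ℝ in 𝓝 0, ∀ b, ((A₁ + (↑t : ℂ) • δ) - H (Dsel (A₁ + (↑t : ℂ) • δ))) b ∈ herm0 (Fin N) := by
  filter_upwards [eventually_ofReal (eventually_weightedBall_line w ε A₁ δ hA₁)] with t ht
  refine (hherm _ ht fun b => ?_).2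
  rw [Pi.add_apply, Pi.smul_apply, Complex.coe_smul]
  exact (herm0 (Fin N)).add_mem (hA₁h b) ((herm0 (Fin N)).smul_mem t (hδh b))
end Readings

/-! ## §1c  Print's multi-level kernel in ♭ letters: `Qlin♭ δ = 0` -/

section Kernel
open LatticeFieldCalculus (bondAvgIter)

/-- **`Qlin♭ δ = 0` FROM THE (2.3)-LETTERED KERNEL**: if `Q_j δ (c) = 0` at every [B6] (2.3) index bond `(j, c)` of the nested family `D` (print's multi-level kernel, straight
iterated averages), then `fderiv ℂ (chartLogFlat η D) 0 δ = 0` (UST ✓`fderiv_chartLogFlat_zero_apply`: `Qlin♭(δ)(j,c) = (η·Lʲ)•Q_j δ(c)`).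
[cite: Balaban1985Variational, (20) p.281, (44)-(45) p.285; Balaban1984PropagatorsII, (2.3) p.224; Balaban1985Averaging, (134) p.38] -/
theorem fderiv_chartLogFlat_zero_eq_zero_of_lamBond (η : ℝ) (D : Domains P) (δ : PBond P 0 → Matrix (Fin N) (Fin N) ℂ)
    (hδ : ∀ (j : ℕ) (c : PBond P j), j ≤ D.k → D.LamBond j c → bondAvgIter j δ c = 0) :
    (fderiv ℂ (chartLogFlat η D : (PBond P 0 → Matrix (Fin N) (Fin N) ℂ) → BondIdx D → Matrix (Fin N) (Fin N) ℂ) 0) δ = 0 := by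
  funext idx
  rw [fderiv_chartLogFlat_zero_apply, hδ (idx.1.1 : ℕ) idx.1.2 (Nat.lt_succ_iff.1 idx.1.1.2) idx.2, smul_zero, Pi.zero_apply]

/-- **THE DICTIONARY `ker Qlin♭ = print's multi-level kernel`** (`η ≠ 0`): `fderiv ℂ (chartLogFlat η D) 0 δ = 0` iff `Q_j δ(c) = 0` at every (2.3) index bond.
[cite: Balaban1985Variational, (20) p.281, (44)-(45) p.285; Balaban1984PropagatorsII, (2.3) p.224] -/
theorem fderiv_chartLogFlat_zero_eq_zero_iff (η : ℝ) (hη : η ≠ 0) (D : Domains P) (δ : PBond P 0 → Matrix (Fin N) (Fin N) ℂ) :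
    (fderiv ℂ (chartLogFlat η D : (PBond P 0 → Matrix (Fin N) (Fin N) ℂ) → BondIdx D → Matrix (Fin N) (Fin N) ℂ) 0) δ = 0 ↔
      ∀ (j : ℕ) (c : PBond P j), j ≤ D.k → D.LamBond j c → bondAvgIter j δ c = 0 := by
  refine ⟨fun h j c hj hc => ?_, fderiv_chartLogFlat_zero_eq_zero_of_lamBond η D δ⟩
  have hidx := congrFun h ⟨⟨⟨j, Nat.lt_succ_iff.2 hj⟩, c⟩, hc⟩
  rw [fderiv_chartLogFlat_zero_apply, Pi.zero_apply, smul_eq_zero] at hidx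
  rcases hidx with hcoef | hQ
  · exfalso
    have hL : (((P.L : ℕ) : ℂ)) ≠ 0 := Nat.cast_ne_zero.2 P.L_pos.ne'
    exact (mul_ne_zero (Complex.ofReal_ne_zero.2 hη) (pow_ne_zero _ hL)) hcoef
  · exact hQ
end Kernel

/-! ## §2  THE KNIT, configuration half: the Wilson action is stationary along the ♭ chart line through a fibre-critical point -/

section Transfer
open T4Continuum (T4Family)

variable (F : T4Family) (N : ℕ) [NeZero N] (K k : ℕ) (D : Domains (F.P K)) (hDk : D.k = k)
  (hcollar : ∀ (i : ℕ) (e : PBond (F.P K) (i + 1)), D.LamBond (i + 1) e → ∀ z : Site (F.P K) i, (blockOf z = e.src ∨ blockOf z = e.tgt) → z ∈ D.Om i)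

/-- bookkeeping: `60800ℓ²LR ≤ 1` implies the two budgets `12800ℓ²LR ≤ 1`, `60800ℓ²R ≤ 1` of `…FlatChartCriticalityTransfer` §2 (`L ≥ 1`). [folklore] -/
theorem budgets_of_hRL {R : ℝ} (hR0 : 0 ≤ R) (hRL : 60800 * ((((F.P K).d + 2) * (F.P K).L : ℕ) : ℝ) ^ 2 * ((F.P K).L : ℝ) * R ≤ 1) :
    12800 * ((((F.P K).d + 2) * (F.P K).L : ℕ) : ℝ) ^ 2 * ((F.P K).L : ℝ) * R ≤ 1 ∧ 60800 * ((((F.P K).d + 2) * (F.P K).L : ℕ) : ℝ) ^ 2 * R ≤ 1 := by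
  have hL1 : (1 : ℝ) ≤ (F.P K).L := by exact_mod_cast (F.P K).L_pos
  have hℓ : (0 : ℝ) ≤ ((((F.P K).d + 2) * (F.P K).L : ℕ) : ℝ) ^ 2 := by positivity
  have hx : 0 ≤ ((((F.P K).d + 2) * (F.P K).L : ℕ) : ℝ) ^ 2 * R := mul_nonneg hℓ hR0
  have hy : 0 ≤ ((((F.P K).d + 2) * (F.P K).L : ℕ) : ℝ) ^ 2 * R * (((F.P K).L : ℝ) - 1) := mul_nonneg hx (by linarith)
  constructor <;> nlinarith

include hDk hcollar in
/-- ★★★ **THE WILSON ACTION IS STATIONARY ALONG THE ♭ CHART LINE THROUGH A FIBRE-CRITICAL POINT** — `…FlatChartCriticalityTransfer` §2 INSTANTIATED at the charted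
family `A z := (A′₁ + z•δ) − H·Dsel(A′₁ + z•δ)` with its three analytic inputs DISCHARGED from the ♭ chart's letters: `hAdiff` (§1, `Dsel` `C^ω` on the `ε`-ball,
`H` linear), `hball` (§1: the line stays in the `ε₁`-ball; the ball link `hchartball` puts the charted field in the `R`-ball), `hidx` (§1 + (49)♭ + `Qlin♭ δ = 0` ⇒ equal
`Q♭`-data ⇒ ✓`dbarIterU_eq_of_chartLogFlat_eq_of_ball`).  LETTERS (k0-s1-w4 `exists_chartDFlat_himp_herm0_T4` ∕ k0-s1-w2 D″, consumed VERBATIM): `H` a ℂ-linear map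
`(BondIdx D → M_N(ℂ)) → (bonds → M_N(ℂ))`, `Dsel` with `ContDiffOn ℂ ω` on the `ε`-ball, (49)♭ on the `ε`-ball; DATA: `A′₁` in the `ε₁`-ball (`ε₁ ≤ ε`), `δ` with
`Qlin♭ δ = 0`; an `SU(N)` family `U` reading `e^{iηA(t)}` for real `t` near `0` (§1b supplies one when `A′₁`, `δ` are Hermitian-traceless); CRITICALITY of `U 0` in the
(2.3)-lettered curve form.  THEN **`(t ↦ 𝔄(U t))′(0) = 0`** — the stationarity INPUT of k0-s1-w2's `inner_hessOpAt_add_re_BE_eq_zero_of_stationary` (♭ (127), `T = 0`).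
[cite: Balaban1985Variational, (5)-(6) p.278, (20) p.281, (44)-(49) p.285, (127)-(128) p.297, (152) p.301, (156)-(157) p.302; Balaban1985Averaging, (92) p.31, (134) p.38; Balaban1984PropagatorsII, (2.3) p.224; Balaban1988Convergent, (2.10)-(2.12) p.256] -/
theorem hasDerivAt_wilsonAction4_zero_of_flatChart_line_critical {w : ℕ → PBond (F.P K) 0 → ℝ} (hw : IsLevWeight (F.P K) k D w) {R : ℝ} (hR0 : 0 ≤ R)
    (hRL : 60800 * ((((F.P K).d + 2) * (F.P K).L : ℕ) : ℝ) ^ 2 * ((F.P K).L : ℝ) * R ≤ 1)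
    (hguard : 60 * ((((F.P K).d + 2) * (F.P K).L : ℕ) : ℝ) ^ 2 * ((F.P K).L : ℝ) * R < deltaSU (Fin N))
    (H : (BondIdx D → Matrix (Fin N) (Fin N) ℂ) →ₗ[ℂ] (PBond (F.P K) 0 → Matrix (Fin N) (Fin N) ℂ))
    (Dsel : (PBond (F.P K) 0 → Matrix (Fin N) (Fin N) ℂ) → (BondIdx D → Matrix (Fin N) (Fin N) ℂ)) {ε ε₁ : ℝ} (hε₁ : ε₁ ≤ ε)
    (hcd : ContDiffOn ℂ ω Dsel {Y : PBond (F.P K) 0 → Matrix (Fin N) (Fin N) ℂ | ∀ b, w 1 b * ‖Y b‖ < ε})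
    (hfix : ∀ A' : PBond (F.P K) 0 → Matrix (Fin N) (Fin N) ℂ, (∀ b, w 1 b * ‖A' b‖ < ε) →
      chartLogFlat ((((F.P K).L : ℝ)⁻¹) ^ k) D (A' - H (Dsel A')) =
        (fderiv ℂ (chartLogFlat ((((F.P K).L : ℝ)⁻¹) ^ k) D :
          (PBond (F.P K) 0 → Matrix (Fin N) (Fin N) ℂ) → BondIdx D → Matrix (Fin N) (Fin N) ℂ) 0) A')
    (hchartball : ∀ A' : PBond (F.P K) 0 → Matrix (Fin N) (Fin N) ℂ, (∀ b, w 1 b * ‖A' b‖ < ε₁) → ∀ b, w 1 b * ‖(A' - H (Dsel A')) b‖ < R)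
    (A₁ δ : PBond (F.P K) 0 → Matrix (Fin N) (Fin N) ℂ) (hA₁ : ∀ b, w 1 b * ‖A₁ b‖ < ε₁)
    (hδ : (fderiv ℂ (chartLogFlat ((((F.P K).L : ℝ)⁻¹) ^ k) D :
      (PBond (F.P K) 0 → Matrix (Fin N) (Fin N) ℂ) → BondIdx D → Matrix (Fin N) (Fin N) ℂ) 0) δ = 0)
    (U : ℝ → GaugeField (F.P K) 0 (Matrix.specialUnitaryGroup (Fin N) ℂ))
    (hU : ∀ᶠ t : ℝ in 𝓝 0, ∀ b, ((U t b : Matrix.specialUnitaryGroup (Fin N) ℂ) : Matrix (Fin N) (Fin N) ℂ) =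
      ((expCfg ((((F.P K).L : ℝ)⁻¹) ^ k) ((A₁ + (↑t : ℂ) • δ) - H (Dsel (A₁ + (↑t : ℂ) • δ))) b : (Matrix (Fin N) (Fin N) ℂ)ˣ) : _))
    (hcrit : ∀ γ : ℝ → GaugeField (F.P K) 0 (Matrix.specialUnitaryGroup (Fin N) ℂ), γ 0 = U 0 →
      DifferentiableAt ℝ (fun (t : ℝ) (b : PBond (F.P K) 0) => ((γ t b : Matrix.specialUnitaryGroup (Fin N) ℂ) : Matrix (Fin N) (Fin N) ℂ)) 0 →
      (∀ (t : ℝ) (j : ℕ) (c : PBond (F.P K) j), j ≤ k → D.LamBond j c → avgFamily (avOfRecord F N K) (γ t) j c = avgFamily (avOfRecord F N K) (U 0) j c) →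
      HasDerivAt (fun t => wilsonAction4 (γ t)) 0 0) :
    HasDerivAt (fun t => wilsonAction4 (U t)) 0 0 := by
  obtain ⟨hR, hRflat⟩ := budgets_of_hRL F K hR0 hRL
  have hA₁ε : ∀ b, w 1 b * ‖A₁ b‖ < ε := fun b => (hA₁ b).trans_le hε₁
  -- the charted family along the line
  let A : ℂ → PBond (F.P K) 0 → Matrix (Fin N) (Fin N) ℂ := fun z => (A₁ + z • δ) - H (Dsel (A₁ + z • δ))
  have hAdiff : DifferentiableAt ℂ A 0 := differentiableAt_flatChart_line w ε H Dsel hcd A₁ δ hA₁ε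
  have hline₁ : ∀ᶠ z in 𝓝 (0 : ℂ), ∀ b, w 1 b * ‖(A₁ + z • δ) b‖ < ε₁ := eventually_weightedBall_line w ε₁ A₁ δ hA₁
  have h0₁ : ∀ b, w 1 b * ‖(A₁ + (0 : ℂ) • δ) b‖ < ε₁ := by simpa using hA₁
  have hA0ball : ∀ b, w 1 b * ‖A 0 b‖ < R := hchartball _ h0₁
  have hball : ∀ᶠ z in 𝓝 (0 : ℂ), ∀ b, w 1 b * ‖A z b‖ < R := hline₁.mono fun z hz => hchartball _ hz
  have hidx : ∀ᶠ z in 𝓝 (0 : ℂ), ∀ idx : BondIdx D,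
      dbarIterU (idx.1.1 : ℕ) (expCfg ((((F.P K).L : ℝ)⁻¹) ^ k) (A z)) idx.1.2 = dbarIterU (idx.1.1 : ℕ) (expCfg ((((F.P K).L : ℝ)⁻¹) ^ k) (A 0)) idx.1.2 :=
    hline₁.mono fun z hz idx => dbarIterU_eq_of_chartLogFlat_eq_of_ball k D hDk hcollar hw hR0 hRL (hchartball _ hz) hA0ball idx
      (congrFun (chartLogFlat_flatChart_line_eq ((((F.P K).L : ℝ)⁻¹) ^ k) w ε H Dsel hfix A₁ δ hA₁ε hδ (fun b => (hz b).trans_le hε₁)) idx)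
  exact hasDerivAt_wilsonAction4_zero_of_flatChart_critical F N K k D hDk hcollar hw hR0 hR hRflat hguard A hAdiff hball hidx U hU hcrit

include hDk hcollar in
/-- ★★★ **THE SAME FROM `Node00.IsCritOnFibre`**: criticality of `U 0` on the fibre `𝔅(𝔹, avgFamily (avOfRecord F N K) (U 0))` for a determining set `𝔹` whose bonds are (2.3)
index bonds of `D` of level `≤ k` (the (ii)-reading of ME #35) ⇒ stationarity along the ♭ chart line.
[cite: Balaban1985Variational, (5)-(6) p.278, (47)-(49) p.285, (156)-(157) p.302; Balaban1988Convergent, (2.10)-(2.12) p.256; Balaban1984PropagatorsII, (2.3) p.224] -/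
theorem hasDerivAt_wilsonAction4_zero_of_flatChart_line_isCritOnFibre {w : ℕ → PBond (F.P K) 0 → ℝ} (hw : IsLevWeight (F.P K) k D w) {R : ℝ} (hR0 : 0 ≤ R)
    (hRL : 60800 * ((((F.P K).d + 2) * (F.P K).L : ℕ) : ℝ) ^ 2 * ((F.P K).L : ℝ) * R ≤ 1)
    (hguard : 60 * ((((F.P K).d + 2) * (F.P K).L : ℕ) : ℝ) ^ 2 * ((F.P K).L : ℝ) * R < deltaSU (Fin N))
    (H : (BondIdx D → Matrix (Fin N) (Fin N) ℂ) →ₗ[ℂ] (PBond (F.P K) 0 → Matrix (Fin N) (Fin N) ℂ))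
    (Dsel : (PBond (F.P K) 0 → Matrix (Fin N) (Fin N) ℂ) → (BondIdx D → Matrix (Fin N) (Fin N) ℂ)) {ε ε₁ : ℝ} (hε₁ : ε₁ ≤ ε)
    (hcd : ContDiffOn ℂ ω Dsel {Y : PBond (F.P K) 0 → Matrix (Fin N) (Fin N) ℂ | ∀ b, w 1 b * ‖Y b‖ < ε})
    (hfix : ∀ A' : PBond (F.P K) 0 → Matrix (Fin N) (Fin N) ℂ, (∀ b, w 1 b * ‖A' b‖ < ε) →
      chartLogFlat ((((F.P K).L : ℝ)⁻¹) ^ k) D (A' - H (Dsel A')) =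
        (fderiv ℂ (chartLogFlat ((((F.P K).L : ℝ)⁻¹) ^ k) D :
          (PBond (F.P K) 0 → Matrix (Fin N) (Fin N) ℂ) → BondIdx D → Matrix (Fin N) (Fin N) ℂ) 0) A')
    (hchartball : ∀ A' : PBond (F.P K) 0 → Matrix (Fin N) (Fin N) ℂ, (∀ b, w 1 b * ‖A' b‖ < ε₁) → ∀ b, w 1 b * ‖(A' - H (Dsel A')) b‖ < R)
    (A₁ δ : PBond (F.P K) 0 → Matrix (Fin N) (Fin N) ℂ) (hA₁ : ∀ b, w 1 b * ‖A₁ b‖ < ε₁)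
    (hδ : (fderiv ℂ (chartLogFlat ((((F.P K).L : ℝ)⁻¹) ^ k) D :
      (PBond (F.P K) 0 → Matrix (Fin N) (Fin N) ℂ) → BondIdx D → Matrix (Fin N) (Fin N) ℂ) 0) δ = 0)
    (U : ℝ → GaugeField (F.P K) 0 (Matrix.specialUnitaryGroup (Fin N) ℂ))
    (hU : ∀ᶠ t : ℝ in 𝓝 0, ∀ b, ((U t b : Matrix.specialUnitaryGroup (Fin N) ℂ) : Matrix (Fin N) (Fin N) ℂ) =
      ((expCfg ((((F.P K).L : ℝ)⁻¹) ^ k) ((A₁ + (↑t : ℂ) • δ) - H (Dsel (A₁ + (↑t : ℂ) • δ))) b : (Matrix (Fin N) (Fin N) ℂ)ˣ) : _))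
    (𝔹 : DetSet (F.P K)) (h𝔹 : ∀ (j : ℕ) (b : PBond (F.P K) j), b ∈ bondsOf (𝔹 j) → j ≤ k ∧ D.LamBond j b)
    (hcrit : IsCritOnFibre F N K 𝔹 (avgFamily (avOfRecord F N K) (U 0)) (U 0)) :
    HasDerivAt (fun t => wilsonAction4 (U t)) 0 0 := by
  refine hasDerivAt_wilsonAction4_zero_of_flatChart_line_critical F N K k D hDk hcollar hw hR0 hRL hguard H Dsel hε₁ hcd hfix hchartball A₁ δ hA₁ hδ U hU
    fun γ hγ0 hγd hγfib => ?_
  refine (Node00.isCritOnFibre_iff_hasDerivAt_zero.1 hcrit) γ hγ0 hγd (Filter.Eventually.of_forall fun t j b hb => ?_)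
  obtain ⟨hj, hlam⟩ := h𝔹 j b hb
  exact hγfib t j b hj hlam

/-! ## §3  ∃-EDITIONS: the `SU(N)` reading family SUPPLIED (Hermitian-traceless data) — no cut-off left for the assembler -/

include hDk hcollar in
/-- ★★★ **STATIONARITY WITH THE READING FAMILY SUPPLIED**: the letters of §2 plus the chart's herm0 row on the `ε`-ball (k0-s1-w4 CLAIM-8's conjunct), `A′₁`, `δ`
Hermitian-traceless, and an `SU(N)` configuration `U₀` reading `e^{iη(A′₁ − H·Dsel A′₁)}` that is critical on the fibre `𝔅(𝔹, avgFamily (avOfRecord F N K) U₀)` for a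
determining set `𝔹` of (2.3) index bonds of level `≤ k` ⟹ there is an `SU(N)` family `U` with `U 0 = U₀`, reading `e^{iη((A′₁ + tδ) − H·Dsel(A′₁ + tδ))}` for real `t` near `0`,
and **`(t ↦ 𝔄(U t))′(0) = 0`**. [cite: Balaban1985Variational, (5)-(6) p.278, (47)-(49) p.285, (152) p.301, (156)-(157) p.302; Balaban1988Convergent, (2.10)-(2.12) p.256; Balaban1984PropagatorsII, (2.3) p.224] -/
theorem exists_suReading_hasDerivAt_wilsonAction4_zero_isCritOnFibre {w : ℕ → PBond (F.P K) 0 → ℝ} (hw : IsLevWeight (F.P K) k D w) {R : ℝ} (hR0 : 0 ≤ R)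
    (hRL : 60800 * ((((F.P K).d + 2) * (F.P K).L : ℕ) : ℝ) ^ 2 * ((F.P K).L : ℝ) * R ≤ 1)
    (hguard : 60 * ((((F.P K).d + 2) * (F.P K).L : ℕ) : ℝ) ^ 2 * ((F.P K).L : ℝ) * R < deltaSU (Fin N))
    (H : (BondIdx D → Matrix (Fin N) (Fin N) ℂ) →ₗ[ℂ] (PBond (F.P K) 0 → Matrix (Fin N) (Fin N) ℂ))
    (Dsel : (PBond (F.P K) 0 → Matrix (Fin N) (Fin N) ℂ) → (BondIdx D → Matrix (Fin N) (Fin N) ℂ)) {ε ε₁ : ℝ} (hε₁ : ε₁ ≤ ε)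
    (hcd : ContDiffOn ℂ ω Dsel {Y : PBond (F.P K) 0 → Matrix (Fin N) (Fin N) ℂ | ∀ b, w 1 b * ‖Y b‖ < ε})
    (hfix : ∀ A' : PBond (F.P K) 0 → Matrix (Fin N) (Fin N) ℂ, (∀ b, w 1 b * ‖A' b‖ < ε) →
      chartLogFlat ((((F.P K).L : ℝ)⁻¹) ^ k) D (A' - H (Dsel A')) =
        (fderiv ℂ (chartLogFlat ((((F.P K).L : ℝ)⁻¹) ^ k) D :
          (PBond (F.P K) 0 → Matrix (Fin N) (Fin N) ℂ) → BondIdx D → Matrix (Fin N) (Fin N) ℂ) 0) A')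
    (hherm : ∀ A' : PBond (F.P K) 0 → Matrix (Fin N) (Fin N) ℂ, (∀ b, w 1 b * ‖A' b‖ < ε) → (∀ b, A' b ∈ herm0 (Fin N)) →
      (∀ i, Dsel A' i ∈ herm0 (Fin N)) ∧ ∀ b, (A' - H (Dsel A')) b ∈ herm0 (Fin N))
    (hchartball : ∀ A' : PBond (F.P K) 0 → Matrix (Fin N) (Fin N) ℂ, (∀ b, w 1 b * ‖A' b‖ < ε₁) → ∀ b, w 1 b * ‖(A' - H (Dsel A')) b‖ < R)
    (A₁ δ : PBond (F.P K) 0 → Matrix (Fin N) (Fin N) ℂ) (hA₁ : ∀ b, w 1 b * ‖A₁ b‖ < ε₁) (hA₁h : ∀ b, A₁ b ∈ herm0 (Fin N))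
    (hδ : (fderiv ℂ (chartLogFlat ((((F.P K).L : ℝ)⁻¹) ^ k) D :
      (PBond (F.P K) 0 → Matrix (Fin N) (Fin N) ℂ) → BondIdx D → Matrix (Fin N) (Fin N) ℂ) 0) δ = 0) (hδh : ∀ b, δ b ∈ herm0 (Fin N))
    (U₀ : GaugeField (F.P K) 0 (Matrix.specialUnitaryGroup (Fin N) ℂ))
    (hU₀ : ∀ b, ((U₀ b : Matrix.specialUnitaryGroup (Fin N) ℂ) : Matrix (Fin N) (Fin N) ℂ) =
      ((expCfg ((((F.P K).L : ℝ)⁻¹) ^ k) (A₁ - H (Dsel A₁)) b : (Matrix (Fin N) (Fin N) ℂ)ˣ) : _))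
    (𝔹 : DetSet (F.P K)) (h𝔹 : ∀ (j : ℕ) (b : PBond (F.P K) j), b ∈ bondsOf (𝔹 j) → j ≤ k ∧ D.LamBond j b)
    (hcrit : IsCritOnFibre F N K 𝔹 (avgFamily (avOfRecord F N K) U₀) U₀) :
    ∃ U : ℝ → GaugeField (F.P K) 0 (Matrix.specialUnitaryGroup (Fin N) ℂ), U 0 = U₀ ∧
      (∀ᶠ t : ℝ in 𝓝 0, ∀ b, ((U t b : Matrix.specialUnitaryGroup (Fin N) ℂ) : Matrix (Fin N) (Fin N) ℂ) =
        ((expCfg ((((F.P K).L : ℝ)⁻¹) ^ k) ((A₁ + (↑t : ℂ) • δ) - H (Dsel (A₁ + (↑t : ℂ) • δ))) b : (Matrix (Fin N) (Fin N) ℂ)ˣ) : _)) ∧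
      HasDerivAt (fun t => wilsonAction4 (U t)) 0 0 := by
  have hA₁ε : ∀ b, w 1 b * ‖A₁ b‖ < ε := fun b => (hA₁ b).trans_le hε₁
  have hAh := eventually_herm0_flatChart_line w ε H Dsel hherm A₁ δ hA₁ε hA₁h hδh
  obtain ⟨U, hU0, hU⟩ := exists_suReading_family ((((F.P K).L : ℝ)⁻¹) ^ k) (fun z => (A₁ + z • δ) - H (Dsel (A₁ + z • δ))) hAh U₀
    (fun b => by rw [hU₀ b, zero_smul, add_zero])
  refine ⟨U, hU0, hU, ?_⟩
  refine hasDerivAt_wilsonAction4_zero_of_flatChart_line_isCritOnFibre F N K k D hDk hcollar hw hR0 hRL hguard H Dsel hε₁ hcd hfix hchartball A₁ δ hA₁ hδ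
    U hU 𝔹 h𝔹 ?_
  rw [hU0]
  exact hcrit

/-! ## §4  ALL LETTERS: the ball link discharged from the sup row of `H` and (55)♭ — the assembler's entry -/

include hDk hcollar in
/-- ★★★★ **THE KNIT, CONFIGURATION HALF, IN THE LETTERS OF k0-s1-w4's `exists_chartDFlat_himp_herm0_T4` ∕ k0-s1-w2's D″** — sup row `w₁(b)‖H X b‖ ≤ B_f·t`, (55)♭
`‖Dsel A′‖ ≤ C_D·ρ′²` on the `ε`-ball, `ContDiffOn ℂ ω Dsel`, (49)♭, the herm0 row; `IsLevWeight` weights with `60800ℓ²LR ≤ 1`, `60ℓ²LR < δ_N` and the data radius `ε₁ ≤ ε` with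
`ε₁ + B_f·C_D·ε₁² ≤ R`; `A′₁` in the `ε₁`-ball, `δ` in `ker Qlin♭`, both Hermitian-traceless; `U₀` reading `e^{iη(A′₁ − H·Dsel A′₁)}` critical on the fibre `𝔅(𝔹, ·)` for a
determining set of (2.3) index bonds of level `≤ k` ⟹ **`∃ U, U 0 = U₀ ∧ (U t reads the ♭ chart line near 0) ∧ (t ↦ 𝔄(U t))′(0) = 0`**.  With k0-s1-w2's (157) `HasFDerivAt`
(D″∕D‴) and `…FlatChartCriticalityTransfer.add_eq_zero_of_hasDerivAt_zero` this is the ♭ (127) `⟪δ, Δ₁A′₁⟫ + ⟨W, δ⟩ = 0` with `T = 0`.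
[cite: Balaban1985Variational, (5)-(6) p.278, (20) p.281, (44)-(49) p.285, (55) p.286, (127)-(128) p.297, (152) p.301, (156)-(157) p.302; Balaban1985Averaging, (92) p.31, (134) p.38; Balaban1984PropagatorsII, (2.3) p.224; Balaban1988Convergent, (2.10)-(2.12) p.256] -/
theorem exists_suReading_hasDerivAt_wilsonAction4_zero_of_letters {w : ℕ → PBond (F.P K) 0 → ℝ} (hw : IsLevWeight (F.P K) k D w) {R : ℝ} (hR0 : 0 ≤ R)
    (hRL : 60800 * ((((F.P K).d + 2) * (F.P K).L : ℕ) : ℝ) ^ 2 * ((F.P K).L : ℝ) * R ≤ 1)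
    (hguard : 60 * ((((F.P K).d + 2) * (F.P K).L : ℕ) : ℝ) ^ 2 * ((F.P K).L : ℝ) * R < deltaSU (Fin N))
    (H : (BondIdx D → Matrix (Fin N) (Fin N) ℂ) →ₗ[ℂ] (PBond (F.P K) 0 → Matrix (Fin N) (Fin N) ℂ))
    (Dsel : (PBond (F.P K) 0 → Matrix (Fin N) (Fin N) ℂ) → (BondIdx D → Matrix (Fin N) (Fin N) ℂ)) {ε ε₁ Bf CD : ℝ} (hε₁0 : 0 ≤ ε₁) (hε₁ : ε₁ ≤ ε)
    (hCD : 0 ≤ CD) (hwin : ε₁ + Bf * CD * ε₁ ^ 2 ≤ R)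
    (hHB : ∀ (X : BondIdx D → Matrix (Fin N) (Fin N) ℂ) (t : ℝ), 0 ≤ t → (∀ c, ‖X c‖ ≤ t) → ∀ b, w 1 b * ‖H X b‖ ≤ Bf * t)
    (h55 : ∀ A' : PBond (F.P K) 0 → Matrix (Fin N) (Fin N) ℂ, (∀ b, w 1 b * ‖A' b‖ < ε) →
      ∀ ρ' : ℝ, 0 ≤ ρ' → (∀ b, w 1 b * ‖A' b‖ ≤ ρ') → ∀ i : BondIdx D, ‖Dsel A' i‖ ≤ CD * ρ' ^ 2)
    (hcd : ContDiffOn ℂ ω Dsel {Y : PBond (F.P K) 0 → Matrix (Fin N) (Fin N) ℂ | ∀ b, w 1 b * ‖Y b‖ < ε})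
    (hfix : ∀ A' : PBond (F.P K) 0 → Matrix (Fin N) (Fin N) ℂ, (∀ b, w 1 b * ‖A' b‖ < ε) →
      chartLogFlat ((((F.P K).L : ℝ)⁻¹) ^ k) D (A' - H (Dsel A')) =
        (fderiv ℂ (chartLogFlat ((((F.P K).L : ℝ)⁻¹) ^ k) D :
          (PBond (F.P K) 0 → Matrix (Fin N) (Fin N) ℂ) → BondIdx D → Matrix (Fin N) (Fin N) ℂ) 0) A')
    (hherm : ∀ A' : PBond (F.P K) 0 → Matrix (Fin N) (Fin N) ℂ, (∀ b, w 1 b * ‖A' b‖ < ε) → (∀ b, A' b ∈ herm0 (Fin N)) →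
      (∀ i, Dsel A' i ∈ herm0 (Fin N)) ∧ ∀ b, (A' - H (Dsel A')) b ∈ herm0 (Fin N))
    (A₁ δ : PBond (F.P K) 0 → Matrix (Fin N) (Fin N) ℂ) (hA₁ : ∀ b, w 1 b * ‖A₁ b‖ < ε₁) (hA₁h : ∀ b, A₁ b ∈ herm0 (Fin N))
    (hδ : (fderiv ℂ (chartLogFlat ((((F.P K).L : ℝ)⁻¹) ^ k) D :
      (PBond (F.P K) 0 → Matrix (Fin N) (Fin N) ℂ) → BondIdx D → Matrix (Fin N) (Fin N) ℂ) 0) δ = 0) (hδh : ∀ b, δ b ∈ herm0 (Fin N))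
    (U₀ : GaugeField (F.P K) 0 (Matrix.specialUnitaryGroup (Fin N) ℂ))
    (hU₀ : ∀ b, ((U₀ b : Matrix.specialUnitaryGroup (Fin N) ℂ) : Matrix (Fin N) (Fin N) ℂ) =
      ((expCfg ((((F.P K).L : ℝ)⁻¹) ^ k) (A₁ - H (Dsel A₁)) b : (Matrix (Fin N) (Fin N) ℂ)ˣ) : _))
    (𝔹 : DetSet (F.P K)) (h𝔹 : ∀ (j : ℕ) (b : PBond (F.P K) j), b ∈ bondsOf (𝔹 j) → j ≤ k ∧ D.LamBond j b)
    (hcrit : IsCritOnFibre F N K 𝔹 (avgFamily (avOfRecord F N K) U₀) U₀) :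
    ∃ U : ℝ → GaugeField (F.P K) 0 (Matrix.specialUnitaryGroup (Fin N) ℂ), U 0 = U₀ ∧
      (∀ᶠ t : ℝ in 𝓝 0, ∀ b, ((U t b : Matrix.specialUnitaryGroup (Fin N) ℂ) : Matrix (Fin N) (Fin N) ℂ) =
        ((expCfg ((((F.P K).L : ℝ)⁻¹) ^ k) ((A₁ + (↑t : ℂ) • δ) - H (Dsel (A₁ + (↑t : ℂ) • δ))) b : (Matrix (Fin N) (Fin N) ℂ)ˣ) : _)) ∧
      HasDerivAt (fun t => wilsonAction4 (U t)) 0 0 :=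
  exists_suReading_hasDerivAt_wilsonAction4_zero_isCritOnFibre F N K k D hDk hcollar hw hR0 hRL hguard H Dsel hε₁ hcd hfix hherm
    (fun A' hA' b => weightedBall_flatChart_of_letters w (isLevWeight_one_nonneg hw) hε₁0 hε₁ hCD hwin H Dsel hHB h55 A' hA' b)
    A₁ δ hA₁ hA₁h hδ hδh U₀ hU₀ 𝔹 h𝔹 hcrit
end Transfer

end Summit.QuantumFields.YangMills.Theorems.K0Stub1FlatChartLineStationarity

end
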